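import Literature.Probability.Moments.IndependentVectorSums
import Mathlib.MeasureTheory.Measure.Real
import HarnessLib

/-!
# Markov tail for weighted sums of independent random vectors (MR07 Lemma 2.11 ⇒ last step of Thm. 5.9)

Topic `Probability/Moments`, sequel of `IndependentVectorSums.lean` (Micciancio–Regev 2007, Lemma 2.11:
`E‖∑ᵢ zᵢ vᵢ‖² ≤ (l + ε m)‖z‖²` for independent `vᵢ` with `E‖vᵢ‖² ≤ l`, `‖E vᵢ‖² ≤ ε`). Fully PROVED,
Mathlib only: the probability form in which MR07 consume Lemma 2.11 at the end of the proof of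
Thm. 5.9 (authors' version p. 24: "by Markov inequality, `Pr{‖(Y − (C + T))z‖ > r} =
Pr{‖(Y − (C + T))z‖² > r²} ≤ 2/3`", with `vᵢ = yᵢ − (cᵢ + tᵢ)` independent discrete Gaussians and the
moment bounds of Lemma 4.3) and, in one dimension, in the proof of Thm. 5.23 (p. 31, eq. (20) ff.).

* `MicciancioRegev2007.measureReal_lt_norm_sum_smul_le` — for `r > 0`,
  `Pr[r < ‖∑ᵢ zᵢ vᵢ‖] ≤ (l + ε m) ‖z‖² / r²`.
* `MicciancioRegev2007.measureReal_lt_norm_sum_smul_le_of_le` — the consumable form: if moreover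
  `(l + ε m)‖z‖² ≤ θ r²` then `Pr[r < ‖∑ᵢ zᵢ vᵢ‖] ≤ θ` (MR07: `θ = 2/3`).

Written for the decomposition of MR07 Thm. 5.23
(`Literature.Computability.Cryptography.MicciancioRegev2007_gapCVP'_to_SIS'`), whose proof runs the
reduction of Thm. 5.9 (through Cor. 5.13) as a subroutine.

## References

* D. Micciancio, O. Regev, *Worst-case to average-case reductions based on Gaussian measures*,
  SIAM J. Comput. 37 (2007) 267–302; authors' version, Lemma 2.11 (p. 10), proof of Thm. 5.9 (p. 24)
  (`lit read doi:10.1137/S0097539705447360`).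
-/

noncomputable section

open MeasureTheory ProbabilityTheory Finset
open scoped InnerProductSpace

namespace Literature.Probability.Moments

variable {Ω : Type*} [MeasurableSpace Ω] {P : Measure Ω} [IsProbabilityMeasure P]
variable {F : Type*} [NormedAddCommGroup F] [InnerProductSpace ℝ F] [CompleteSpace F]
  [MeasurableSpace F] [BorelSpace F]

/-- **Markov tail of MR07 Lemma 2.11** (Micciancio–Regev 2007, proof of Thm. 5.9, p. 24): for
independent square-integrable random vectors `vᵢ` with `E‖vᵢ‖² ≤ l`, `‖E vᵢ‖² ≤ ε`, every `z ∈ ℝᵐ`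
and `r > 0`, `Pr[r < ‖∑ᵢ zᵢ vᵢ‖] ≤ (l + ε m)(∑ᵢ zᵢ²)/r²` — Markov's inequality for `‖∑ᵢ zᵢ vᵢ‖²`
and `MicciancioRegev2007.integral_norm_sq_sum_smul_le`.
[cite: MicciancioRegev2007, Thm. 5.9 (proof, p. 24, Markov step with Lemma 2.11)] -/
theorem MicciancioRegev2007.measureReal_lt_norm_sum_smul_le {m : ℕ} {V : Fin m → Ω → F}
    (hind : iIndepFun V P) (hL2 : ∀ i, MemLp (V i) 2 P) {l ε : ℝ}
    (hl : ∀ i, ∫ ω, ‖V i ω‖ ^ 2 ∂P ≤ l) (hε : ∀ i, ‖∫ ω, V i ω ∂P‖ ^ 2 ≤ ε) (z : Fin m → ℝ)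
    {r : ℝ} (hr : 0 < r) :
    P.real {ω | r < ‖∑ i, z i • V i ω‖} ≤ (l + ε * m) * (∑ i, z i ^ 2) / r ^ 2 := by
  -- the squared norm of the sum is integrable (the sum is in `L²`)
  have hsum : MemLp (fun ω => ∑ i, z i • V i ω) 2 P :=
    memLp_finsetSum _ fun i _ => (hL2 i).const_smul (z i)
  have hint : Integrable (fun ω => ‖∑ i, z i • V i ω‖ ^ 2) P :=
    (memLp_two_iff_integrable_sq_norm hsum.aestronglyMeasurable).1 hsum
  have hmarkov := mul_meas_ge_le_integral_of_nonneg (μ := P) (ae_of_all _ fun ω => sq_nonneg _) hint (r ^ 2)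
  have hE := MicciancioRegev2007.integral_norm_sq_sum_smul_le hind hL2 hl hε z
  have hsub : {ω | r < ‖∑ i, z i • V i ω‖} ⊆ {ω | r ^ 2 ≤ ‖∑ i, z i • V i ω‖ ^ 2} := fun ω hω =>
    pow_le_pow_left₀ hr.le (le_of_lt hω) 2
  have hr2 : 0 < r ^ 2 := by positivity
  calc P.real {ω | r < ‖∑ i, z i • V i ω‖} ≤ P.real {ω | r ^ 2 ≤ ‖∑ i, z i • V i ω‖ ^ 2} :=
        measureReal_mono hsub
    _ ≤ (∫ ω, ‖∑ i, z i • V i ω‖ ^ 2 ∂P) / r ^ 2 := by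
        rw [le_div_iff₀ hr2, mul_comm]
        exact hmarkov
    _ ≤ (l + ε * m) * (∑ i, z i ^ 2) / r ^ 2 := div_le_div_of_nonneg_right hE hr2.le

/-- **The consumable form** (MR07 p. 24: `E ≤ (2/3) r²`, hence probability `≤ 2/3`): if
`(l + ε m)(∑ᵢ zᵢ²) ≤ θ r²` then `Pr[r < ‖∑ᵢ zᵢ vᵢ‖] ≤ θ`.
[cite: MicciancioRegev2007, Thm. 5.9 (proof, p. 24, Markov step with Lemma 2.11)] -/
theorem MicciancioRegev2007.measureReal_lt_norm_sum_smul_le_of_le {m : ℕ} {V : Fin m → Ω → F}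
    (hind : iIndepFun V P) (hL2 : ∀ i, MemLp (V i) 2 P) {l ε : ℝ}
    (hl : ∀ i, ∫ ω, ‖V i ω‖ ^ 2 ∂P ≤ l) (hε : ∀ i, ‖∫ ω, V i ω ∂P‖ ^ 2 ≤ ε) (z : Fin m → ℝ)
    {r θ : ℝ} (hr : 0 < r) (hθ : (l + ε * m) * (∑ i, z i ^ 2) ≤ θ * r ^ 2) :
    P.real {ω | r < ‖∑ i, z i • V i ω‖} ≤ θ := by
  refine (MicciancioRegev2007.measureReal_lt_norm_sum_smul_le hind hL2 hl hε z hr).trans ?_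
  rw [div_le_iff₀ (by positivity)]
  exact hθ

end Literature.Probability.Moments

end
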